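import Literature.Analysis.FluidPDE.FluidComputer.ThresholdLevelTableU
import HarnessLib

/-!
# Kernel run of the re-cut table over the 10⁻² box, chunks 28 … 31 (bp3 gen 13, layer 4: robustness variant U)

HONEST FRAMING: low prior, high value-of-information experiment on Tao's machine paradigm; NOT a
claim that NS blows up.

Four kernel evaluations (`decide +kernel`; no `native_decide`, no extra axioms) of the checker
`runSteps` (`ThresholdLevelCheck.lean`) with the interval gate data `GIu` (all seven data within
relative `10⁻²`) on ≤ 25 steps of `ThresholdLevelTableU.stepsU` at a time, from `Bu i` towards the next chunk's
first level, returning `Bu (i+1)` (`Bu 0 = ThresholdLevelTable.Bc0`).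
-/

namespace Literature.Analysis.FluidPDE.FluidComputer

namespace ThresholdLevelTableU

open ThresholdLevelTable (Bc0 RbIt)

set_option maxHeartbeats 10000000 in
set_option maxRecDepth 200000 in
/-- Chunk 28 of the re-cut table run over the 10⁻² box (steps 700 … 724). [folklore] -/
theorem runU28 : runSteps 60 12 3 GIu RbIt Bu28 chunkU28 5875997653566133 = some Bu29 := by
  decide +kernel

set_option maxHeartbeats 10000000 in
set_option maxRecDepth 200000 in
/-- Chunk 29 of the re-cut table run over the 10⁻² box (steps 725 … 749). [folklore] -/
theorem runU29 : runSteps 60 12 3 GIu RbIt Bu29 chunkU29 6410358830024270 = some Bu30 := by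
  decide +kernel

set_option maxHeartbeats 10000000 in
set_option maxRecDepth 200000 in
/-- Chunk 30 of the re-cut table run over the 10⁻² box (steps 750 … 774). [folklore] -/
theorem runU30 : runSteps 60 12 3 GIu RbIt Bu30 chunkU30 6993399406123605 = some Bu31 := by
  decide +kernel

set_option maxHeartbeats 10000000 in
set_option maxRecDepth 200000 in
/-- Chunk 31 of the re-cut table run over the 10⁻² box (steps 775 … 799). [folklore] -/
theorem runU31 : runSteps 60 12 3 GIu RbIt Bu31 chunkU31 7629376708093743 = some Bu32 := by
  decide +kernel

end ThresholdLevelTableU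

end Literature.Analysis.FluidPDE.FluidComputer
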